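import Mathlib
import Literature.FieldTheory.FiniteFields.TracesAndNorms

/-!
# STUB-IDEAS k1 g28 — `stub_heegnerIndexLowerAtTwo` · technique «weaken / strengthen»
# «SEAM & WITNESS» — R200's seam closed by valuation parity; R196‴ weakened to one witness per key

Crux item `stmt-BirchSwinnertonDyer-27851` (`PrintCf2.SplitBadTwoLowerHalfOfFacts`), stub of record
`stub_heegnerIndexLowerAtTwo` (active skeleton sha16 `f2bd84c029a8a938`).  This file is the TYPED part of the
idea card `Ideas/stub-heegnerindexloweratwo-k1-g28.md`.  It proves no BSD statement: **BSD is NOT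
proved by any of this**; neither the crux nor the LOWER inequality of the stub is proved here.
Position w.r.t. STUB-PLAN v5.8 (g31): rows 85/86 (untwisted `U_∞ ≅ 𝔪`; keyed law `[i ∈ L_n]`) are OF
RECORD and are NOT re-derived as a deliverable here (K32/K33); what is typed is what v5.8 leaves open at `v`:

* §E  **R200, SEAM half — PROVED in the abstract**: for ANY quadratic `σ` on an abelian group `A` (= `L^×`
      additively) with a `σ`-invariant valuation `v`, `F`-elements of even valuation (`e = 2`), a
      uniformizer `π` (`v π = 1`) and Hilbert 90 (`ker(1+σ) = im(1-σ)` on `A`):  the norm-one units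
      `M = U ∩ ker(1+σ)` satisfy `M = D ⊔ (D + (π - σπ))`, `π - σπ ∉ D`, `[M : D] = 2` EXACTLY
      (`D = (1-σ)U`) — no Herbrand quotient, no class field theory; `2^j·(π-σπ) ∈ D` (`j ≥ 1`), so every
      norm step of the unramified tower KILLS the seam class (`seam_dies_under_norm`) and
      `lim_n M_{L_n} = lim_n (1-σ)U_{L_n}`; log-corollary: `log M = log D` iff the seam generator is
      torsion (`i`, `-1`: conductor-4 keys with `i ∈ L_n`, all conductor-8 keys) — the one exception
      `(u,n) = (3,0)` (`ε₃ = -(2+√3)`) is exactly row 86's «jump», which is therefore INVISIBLE in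
      `H¹_Iw` (universal norms at `(3,0)`: `4√3ℤ₂ = 2·AS₀·√3`, not `2√3ℤ₂`);
* §H  **R196‴ WEAKENED to what LOWER consumes**: `ϖ_v(key) ≤ 1` needs no lattice EQUALITY and no
      uniformity in `n` — only ONE norm-coherent witness `z ∈ lim D` with a layer component
      `Lg_u(z_n) ∉ 4𝒪_{F_n}` (`not_four_dvd_of_witness`, `not_mem_span_four_of_map`); witnesses:
      conductor 8, layer 0, `x = 1+√u`; conductor 4, layer 1, `x = 1 + ω(1+i)` (`℘(ω̄) = 1`);
* §A–§D, §F, §G  (written before row 86 landed; kept as an INDEPENDENT third derivation / cross-check of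
      the keyed law and as typed glue the R196‴ typer can reuse): coordinates on `𝒪_F ⊕ s𝒪_F`, the
      ramified valuation bookkeeping, `℘(k) = ker Tr` from the TREE, the glue `B = ⊤ | B = 𝒪_F^℘` from
      two analytic inputs, layer-0 anchors mod 8, `f(χ_u)/2 - v₂(√u) = 1` key-free, the ceiling Props.

Dictionary (as k1-g27/k3-g29/k3-g30): `F = F_n` a finite layer of the étale line at `v` (`F_∞ = ℚ₂^{ur,2}`),
`k = 𝒪_F/2`, `L = F(√u)`, `σ`, `M_L = U(L)^{N=1} = H¹(F, ℤ₂(1)⊗χ_u)` (B46), `D_L = (1-σ)U(L)`,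
`Lg_u(z) = log z/√u ∈ F`, `pr_s(α + βs) = β`.  The 2-adic `log` itself is the TREE's
`Literature.IUT.LogVolume` (`unitLog`, `unitLog_norm_eq_trace_unitLog`, `unitLog_eq_zero_iff_isTorsionUnit`,
`norm_unitLog_one_add_eq_unif_of_sq_eq`) — no definition is requested (v5.8 P19′/B47).
Nothing here imports harness code; no `sorry`, no new axioms.
-/

namespace Summit.BirchSwinnertonDyer.BirchSwinnertonDyer.Cruxes.SplitBadTwoLowerHalfOfFacts.SeamWitnessK1G28

/-! ## §A  Coordinates on `R[s]/(s² - u)` : the three identities -/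
section QuadProj
variable {R : Type*} [CommRing R]

/-- multiplication of `re + im·s` in `R[s]/(s² - u)`, on coordinate pairs `(re, im)`. -/
def qmul (u : R) (x y : R × R) : R × R := (x.1 * y.1 + u * x.2 * y.2, x.1 * y.2 + x.2 * y.1)

@[simp] theorem qmul_fst (u : R) (x y : R × R) : (qmul u x y).1 = x.1 * y.1 + u * x.2 * y.2 := rfl
@[simp] theorem qmul_snd (u : R) (x y : R × R) : (qmul u x y).2 = x.1 * y.2 + x.2 * y.1 := rfl

/-- (A0) the `s`-projection of ANY square is even: `im((A + C s)²) = 2AC`.  This disposes of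
`x⁴/4 = (x²/2)²`, `x⁸/8 = 2(x⁴/4)²`, … in both types. -/
theorem im_sq (u A C : R) : (qmul u (A, C) (A, C)).2 = 2 * (A * C) := by
  simp [qmul]; ring

/-- (A1, TYPE I: `u = 1 + 2w`, uniformizer `π = 1 + s`) for `x = β·π + 2c = (β + 2c) + β·s`:
`im(x²) = 2·(β² + 2βc)`, i.e. `pr_s(x²/2) ≡ β² (mod 2)` — the Artin–Schreier term. -/
theorem im_sq_typeI (w β c : R) :
    (qmul (1 + 2 * w) (β + 2 * c, β) (β + 2 * c, β)).2 = 2 * (β ^ 2 + 2 * β * c) := by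
  simp [qmul]; ring

/-- … and its `F`-part is even too (it never enters `Lg_u`). -/
theorem re_sq_typeI (w β c : R) :
    (qmul (1 + 2 * w) (β + 2 * c, β) (β + 2 * c, β)).1
      = 2 * ((1 + w) * β ^ 2 + 2 * β * c + 2 * c ^ 2) := by
  simp [qmul]; ring

/-- (A2, TYPE II: `u = 2w`, uniformizer `π = s`) for `x = a·s + 2wb = (2wb) + a·s`:
`im(x²) = 2·(2wab)`, i.e. `pr_s(x²/2) ≡ 0 (mod 2)` — NO Artin–Schreier term for even keys. -/
theorem im_sq_typeII (w a b : R) :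
    (qmul (2 * w) (2 * w * b, a) (2 * w * b, a)).2 = 2 * (2 * w * a * b) := by
  simp [qmul]; ring

theorem re_sq_typeII (w a b : R) :
    (qmul (2 * w) (2 * w * b, a) (2 * w * b, a)).1 = 2 * (w * a ^ 2 + 2 * w ^ 2 * b ^ 2) := by
  simp [qmul]; ring

/-- `(1 - σ)(α + βs) = 2β·s`: the Hilbert-90 presentation `z = y/σy` doubles the `s`-coordinate of
`log y`; hence `log((U¹_L)^{1-σ}) = 2s·pr_s(log U¹_L)`. -/
theorem one_sub_sigma (α β : R) : ((α, β) : R × R) - (α, -β) = (0, 2 * β) :=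
  Prod.ext (by simp) (by simp [two_mul])

/-- uniformizer ratio `ε = π/σπ`: TYPE II `σs = -s` gives `ε = -1`; TYPE I with `u = -1`
(`π = 1 + i`) gives `ε = i` since `(1+i) = i·(1-i)`; both torsion, so `log ε = 0`. -/
theorem eps_typeI_neg_one : qmul (-1 : ℤ) (0, 1) (1, -1) = (1, 1) := by simp [qmul]

/-- TYPE I with `u = 3` at layer 0: `ε₃ = (1+√3)/(1-√3) = -(2+√3)` since `(1+√3) = -(2+√3)(1-√3)`;
`2 + √3` has norm `1` and is NOT torsion (it is `1 + π ∉ ±U⁽²⁾`): the one layer-0 anomaly. -/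
theorem eps_typeI_three : qmul (3 : ℤ) (-2, -1) (1, -1) = (1, 1) ∧ (2 : ℤ) ^ 2 - 3 * 1 ^ 2 = 1 := by
  refine ⟨by simp [qmul], by norm_num⟩

end QuadProj

/-! ## §B  Valuation bookkeeping in a ramified quadratic layer (`v_L(2) = 2`) -/

theorem two_mul_add_two_le_two_pow {k : ℕ} (hk : 3 ≤ k) : 2 * k + 2 ≤ 2 ^ k := by
  induction k, hk using Nat.le_induction with
  | base => norm_num
  | succ n hn ih => rw [pow_succ]; omega

/-- The term `x^m/m` of `log(1+x)`, `v_L(x) ≥ 1`, has `v_L ≥ m - 2·v₂(m) ≥ 2` for every `m ≥ 3`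
other than `m = 4`; since `pr_s(π_L^j 𝒪_L) = 2^{⌊j/2⌋}𝒪_F`, such terms project into `2𝒪_F`.
(The exceptional `m ∈ {2, 4}` are handled by §A.) -/
theorem two_mul_padicValNat_two_add_two_le {m : ℕ} (h3 : 3 ≤ m) (h4 : m ≠ 4) :
    2 * padicValNat 2 m + 2 ≤ m := by
  obtain ⟨k, hk⟩ : ∃ k, padicValNat 2 m = k := ⟨_, rfl⟩
  have hdvd : 2 ^ k ∣ m := hk ▸ pow_padicValNat_dvd
  have hle : 2 ^ k ≤ m := Nat.le_of_dvd (by omega) hdvd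
  rw [hk]
  rcases Nat.lt_or_ge k 3 with hk3 | hk3
  · interval_cases k
    · omega
    · norm_num at hdvd; omega
    · norm_num at hdvd; omega
  · have := two_mul_add_two_le_two_pow hk3
    omega

/-! ## §C  `℘(k) = ker Tr` (tree, additive Hilbert 90) and the lattice `𝒪_F^℘` -/

/-- `℘ : z ↦ z² + z` is additive in characteristic `2`. -/
def artinSchreierHom (k : Type*) [CommRing k] [CharP k 2] : k →+ k where
  toFun z := z ^ 2 + z
  map_zero' := by simp
  map_add' x y := by rw [CharTwo.add_sq]; ring

@[simp] theorem artinSchreierHom_apply (k : Type*) [CommRing k] [CharP k 2] (z : k) :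
    artinSchreierHom k z = z ^ 2 + z := rfl

/-- additive Hilbert 90 at `p = 2`, BY NAME from the tree
(`Literature.FieldTheory.FiniteFields.TracesAndNorms.trace_eq_zero_iff_exists_pow_card_sub`,
Lidl–Niederreiter Thm 2.25): `c ∈ ℘(k) ↔ Tr_{k/𝔽₂}(c) = 0`.  In a normal basis this says
`℘(k_n) ↔ augmentation ideal of 𝔽₂[G_n]`, whence `𝒪_{F_n}^℘ ↔ 𝔪_n = (2, I_{G_n})` (k1-g27 (A3)). -/
theorem mem_artinSchreier_range_iff_trace_eq_zero (k : Type*) [Field k] [Fintype k] [CharP k 2]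
    [Algebra (ZMod 2) k] (c : k) :
    c ∈ (artinSchreierHom k).range ↔ Algebra.trace (ZMod 2) k c = 0 := by
  rw [Literature.FieldTheory.FiniteFields.TracesAndNorms.trace_eq_zero_iff_exists_pow_card_sub
    (ZMod 2) k c, ZMod.card, AddMonoidHom.mem_range]
  simp only [artinSchreierHom_apply, CharTwo.sub_eq_add]
  constructor <;> rintro ⟨z, hz⟩ <;> exact ⟨z, hz.symm⟩

/-- `𝒪_F^℘ := {b : b mod 2 ∈ ℘(k)}` — TYPE I's lattice (`= log U¹(F)/2` on the untwisted line,
k1-g27 (A2)); `red` is reduction `𝒪_F → k`. -/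
def wpLattice {O k : Type*} [CommRing O] [CommRing k] [CharP k 2] (red : O →+* k) :
    AddSubgroup O :=
  (artinSchreierHom k).range.comap red.toAddMonoidHom

theorem mem_wpLattice {O k : Type*} [CommRing O] [CommRing k] [CharP k 2] (red : O →+* k) (b : O) :
    b ∈ wpLattice red ↔ ∃ z : k, z ^ 2 + z = red b := by
  simp [wpLattice, AddMonoidHom.mem_range]

/-- `℘(k)` has index `2` in `k` (kernel of the surjective trace to `𝔽₂`). -/
theorem index_artinSchreier_range (k : Type*) [Field k] [Fintype k] [CharP k 2] [Algebra (ZMod 2) k] :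
    (artinSchreierHom k).range.index = 2 := by
  have hker : (artinSchreierHom k).range = (Algebra.trace (ZMod 2) k).toAddMonoidHom.ker := by
    ext c
    rw [mem_artinSchreier_range_iff_trace_eq_zero, AddMonoidHom.mem_ker]
    rfl
  haveI : FiniteDimensional (ZMod 2) k := Module.Finite.of_finite
  have hsurj : Function.Surjective (Algebra.trace (ZMod 2) k).toAddMonoidHom :=
    Algebra.trace_surjective (ZMod 2) k
  rw [hker, AddSubgroup.index_ker, AddMonoidHom.range_eq_top.mpr hsurj, AddSubgroup.card_top,
    Nat.card_zmod]

/-- hence `𝒪_F^℘` has index `2` in `𝒪_F` whenever reduction is onto (the ONE universal bit). -/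
theorem index_wpLattice {O k : Type*} [CommRing O] [Field k] [Fintype k] [CharP k 2]
    [Algebra (ZMod 2) k] (red : O →+* k) (hred : Function.Surjective red) :
    (wpLattice red).index = 2 := by
  unfold wpLattice
  rw [AddSubgroup.index_comap_of_surjective _ (by exact hred), index_artinSchreier_range]

/-! ## §D  The GLUE: from the two analytic inputs to the lattice (kernel-checked)

`B := pr_s(log U¹_L) ⊆ 𝒪_F`.  Analytic input (i) «`log : U_L⁽³⁾ ≅ π_L³𝒪_L` and
`pr_s(π_L³𝒪_L) = 2𝒪_F`» gives `2𝒪_F ⊆ B`; analytic input (ii) is the projection congruence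
`pr_s(log(1+x)) ≡ a (TYPE II, x = a s + 2wb)` resp. `≡ ℘(β̄) (TYPE I, x = βπ + 2c)` mod `2𝒪_F`,
which is §A + §B + (i).  The deductions below are the typed form of «B = 𝒪_F» / «B = 𝒪_F^℘». -/

/-- TYPE II glue (even keys `u ∈ {±2, ±6}`): `B = 𝒪_F`; so `log U(F(√u))^{N=1} = 2√u·𝒪_F`,
`M_L = {±1} × M_L⁽³⁾`, and up the unramified tower `M_∞ ≅ 𝒪_∞ ≅ Λ_v` FREE, `Lg_u = 2·(iso)`. -/
theorem glue_typeII {O : Type*} [CommRing O] (B : AddSubgroup O)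
    (hU3 : ∀ c : O, 2 * c ∈ B) (hproj : ∀ a : O, ∃ c : O, a + 2 * c ∈ B) : B = ⊤ := by
  rw [eq_top_iff]
  intro a _
  obtain ⟨c, hc⟩ := hproj a
  simpa using B.sub_mem hc (hU3 c)

/-- TYPE I glue (odd keys, `L = F(i)`): `B = 𝒪_F^℘`; so `log U(F(i))^{N=1} = i·2𝒪_F^℘ = i·log U¹(F)`
— the SAME lattice as the untwisted line: `M_∞/tors ≅ U_∞ ≅ 𝔪`, `Lg_u = 2·(𝔪 ↪ Λ_v)`. -/
theorem glue_typeI {O k : Type*} [CommRing O] [CommRing k] [CharP k 2] (red : O →+* k)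
    (hred : Function.Surjective red) (hker : ∀ x : O, red x = 0 → ∃ c : O, x = 2 * c)
    (B : AddSubgroup O) (hU3 : ∀ c : O, 2 * c ∈ B)
    (hproj : ∀ b ∈ B, ∃ z : k, z ^ 2 + z = red b)
    (hhit : ∀ β : O, ∃ b ∈ B, red b = red β ^ 2 + red β) :
    B = wpLattice red := by
  ext x
  rw [mem_wpLattice]
  refine ⟨hproj x, ?_⟩
  rintro ⟨z, hz⟩
  obtain ⟨β, rfl⟩ := hred z
  obtain ⟨b, hb, hbx⟩ := hhit β
  have h0 : red (x - b) = 0 := by rw [map_sub, hbx, hz, sub_self]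
  obtain ⟨c, hc⟩ := hker _ h0
  have hx : x = b + 2 * c := by rw [← hc]; ring
  rw [hx]
  exact B.add_mem hb (hU3 c)

/-- TYPE I, general odd unit key `u = 1 + 2w` with `L ≠ F(i)` (only `u = 3` at layer `0` for us):
`Lg_u(M_L) = ℤ₂·λ + 2B` with `λ = Lg_u(ε)`, `ε = π^{1-σ}`, and `λ ∈ B` because `ε² = (w+π)^{1-σ}`.
Typed: a subgroup between `2B` and `B` generated over `2B` by one element. (Layer 0, `u = 3`:
`λ ≡ -2 (mod 8)`, `2B = 4ℤ₂`, so `Lg₃(M) = 2ℤ₂` — index `2`, not `4`; from layer `1` on `3 ∼ -1`.) -/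
theorem typeI_general_sandwich {O : Type*} [CommRing O] (B LgM : AddSubgroup O) (lam : O)
    (hlam : lam ∈ B) (_h2B : ∀ b ∈ B, 2 * b ∈ LgM) (hgen : ∀ x ∈ LgM, ∃ n : ℤ, ∃ b ∈ B, x = n • lam + 2 * b) :
    LgM ≤ B := by
  intro x hx
  obtain ⟨n, b, hb, rfl⟩ := hgen x hx
  exact B.add_mem (B.zsmul_mem hlam n) (by simpa [two_mul] using B.add_mem hb hb)

/-! ## §E  R200 — the seam `M_L/(1-σ)U_L = Ĥ⁻¹(C₂, U_L) ≅ ℤ/2·[π^{1-σ}]`, by valuation parity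

Additive notation for the multiplicative group `A = L^×`: `σ` the involution, `v = v_L`,
`U = ker v`, `M = U ∩ ker(1+σ)` (norm-one units), `D = (1-σ)U`.  Inputs: `σσ = 1`, `v∘σ = v`,
`σ`-FIXED elements have EVEN valuation (`e(L/F) = 2`), a uniformizer `π`, and Hilbert 90 on `A`
(Mathlib `groupCohomology.exists_div_of_norm_eq_one` : `∃ y : Lˣ, y / g y = x`, tree
`Literature.RingTheory.GaloisAlgebras.hilbert90_cyclic` — entered as the hypothesis `h90`). -/

section Seam

variable {A : Type*} [AddCommGroup A] (σ : A →+ A) (v : A →+ ℤ)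

/-- norm-one units `M = ker v ∩ ker(1+σ)`. -/
def normOne : AddSubgroup A := v.ker ⊓ (AddMonoidHom.id A + σ).ker

/-- `D = (1-σ)(ker v)`. -/
def oneSubSigmaUnits : AddSubgroup A := (v.ker).map (AddMonoidHom.id A - σ)

theorem mem_normOne {a : A} : a ∈ normOne σ v ↔ v a = 0 ∧ a + σ a = 0 := by
  simp [normOne, AddSubgroup.mem_inf, AddMonoidHom.mem_ker]

theorem mem_oneSubSigmaUnits {a : A} :
    a ∈ oneSubSigmaUnits σ v ↔ ∃ u : A, v u = 0 ∧ u - σ u = a := by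
  simp [oneSubSigmaUnits, AddSubgroup.mem_map, AddMonoidHom.mem_ker]

theorem mem_oneSubSigmaUnits_of {a u : A} (hu : v u = 0) (h : u - σ u = a) :
    a ∈ oneSubSigmaUnits σ v :=
  (mem_oneSubSigmaUnits σ v).mpr ⟨u, hu, h⟩

/-- `D ≤ M`. -/
theorem oneSubSigmaUnits_le_normOne (hσ : ∀ a, σ (σ a) = a) (hv : ∀ a, v (σ a) = v a) :
    oneSubSigmaUnits σ v ≤ normOne σ v := by
  intro a ha
  obtain ⟨u, hu, rfl⟩ := (mem_oneSubSigmaUnits σ v).mp ha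
  refine (mem_normOne σ v).mpr ⟨by simp [hv, hu], ?_⟩
  rw [map_sub, hσ]; abel

/-- the seam generator `π - σπ` (`= π^{1-σ}`: `i`, `-1`, `-(2+√3)` for `u = -1`, `u` even, `u = 3`)
is a norm-one unit … -/
theorem seamGen_mem (hσ : ∀ a, σ (σ a) = a) (hv : ∀ a, v (σ a) = v a) (π : A) :
    π - σ π ∈ normOne σ v := by
  refine (mem_normOne σ v).mpr ⟨by simp [hv], ?_⟩
  rw [map_sub, hσ]; abel

/-- … which is NOT in `D = (1-σ)U`: else `π - u` would be `σ`-fixed of valuation `1` (parity). -/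
theorem seamGen_not_mem (hF : ∀ a, σ a = a → (2 : ℤ) ∣ v a) {π : A} (hπ : v π = 1) :
    π - σ π ∉ oneSubSigmaUnits σ v := by
  intro h
  obtain ⟨u, hu, h⟩ := (mem_oneSubSigmaUnits σ v).mp h
  have hfix : σ (π - u) = π - u := by
    rw [map_sub, ← sub_eq_zero, show σ π - σ u - (π - u) = (u - σ u) - (π - σ π) by abel, h, sub_self]
  have h2 := hF _ hfix
  rw [map_sub, hπ, hu] at h2
  omega

/-- twice the seam generator IS in `D`:  `(π - σπ) - σ(π - σπ) = 2(π - σπ)`. -/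
theorem two_nsmul_seamGen_mem (hσ : ∀ a, σ (σ a) = a) (hv : ∀ a, v (σ a) = v a) (π : A) :
    2 • (π - σ π) ∈ oneSubSigmaUnits σ v :=
  mem_oneSubSigmaUnits_of σ v (u := π - σ π) (by simp [hv]) (by rw [map_sub, hσ]; abel)

/-- a class killed by `2` is killed by every `2^j`, `j ≥ 1` (the transition maps of the tower). -/
theorem pow_nsmul_mem_of_two_nsmul_mem (H : AddSubgroup A) {a : A}
    (h2 : 2 • a ∈ H) {j : ℕ} (hj : 1 ≤ j) : 2 ^ j • a ∈ H := by
  obtain ⟨i, rfl⟩ := Nat.exists_eq_add_of_le hj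
  rw [show (2 : ℕ) ^ (1 + i) = 2 * 2 ^ i by ring, mul_nsmul]
  exact H.nsmul_mem h2 _

/-- hence `N_{L_m/L_n}(π^{1-σ}) = (π^{1-σ})^{2^{m-n}} ∈ D_{L_n}` for `m > n` (`π ∈ L_0`). -/
theorem pow_nsmul_seamGen_mem (hσ : ∀ a, σ (σ a) = a) (hv : ∀ a, v (σ a) = v a) (π : A)
    {j : ℕ} (hj : 1 ≤ j) : 2 ^ j • (π - σ π) ∈ oneSubSigmaUnits σ v :=
  pow_nsmul_mem_of_two_nsmul_mem (oneSubSigmaUnits σ v) (two_nsmul_seamGen_mem σ v hσ hv π) hj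

/-- THE SEAM DICHOTOMY: every norm-one unit is in `D` or in `D + (π - σπ)` (Hilbert 90 + reduction
of `v b` mod `2` along the `σ`-fixed element `π + σπ` of valuation `2`). -/
theorem seam_dichotomy (hσ : ∀ a, σ (σ a) = a) (hv : ∀ a, v (σ a) = v a)
    (h90 : ∀ a : A, a + σ a = 0 → ∃ b : A, a = b - σ b) {π : A} (hπ : v π = 1)
    {a : A} (ha : a ∈ normOne σ v) :
    a ∈ oneSubSigmaUnits σ v ∨ a - (π - σ π) ∈ oneSubSigmaUnits σ v := by
  obtain ⟨-, hN⟩ := (mem_normOne σ v).mp ha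
  obtain ⟨b, rfl⟩ := h90 a hN
  obtain ⟨q, hq⟩ := Int.even_or_odd' (v b)
  -- shift `b` by `q • (π + σπ)` (σ-fixed, valuation 2): same `(1-σ)`-image, valuation `v b - 2q`
  set b₀ : A := b - q • (π + σ π) with hb₀
  have hfix : b₀ - σ b₀ = b - σ b := by
    rw [hb₀, map_sub, map_zsmul, map_add, hσ, add_comm (σ π) π]; abel
  have hv₀ : v b₀ = v b - 2 * q := by
    rw [hb₀, map_sub, map_zsmul, map_add, hv, hπ]; ring
  rcases hq with hq | hq
  · left
    exact mem_oneSubSigmaUnits_of σ v (u := b₀) (by rw [hv₀, hq]; ring) hfix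
  · right
    refine mem_oneSubSigmaUnits_of σ v (u := b₀ - π) (by rw [map_sub, hv₀, hq, hπ]; ring) ?_
    rw [map_sub, ← hfix]; abel

/-- `[M : D] = 2` exactly: `Ĥ⁻¹(C₂, U_L) ≅ ℤ/2`, generated by `[π^{1-σ}]`. -/
theorem seam_relIndex_eq_two (hσ : ∀ a, σ (σ a) = a) (hv : ∀ a, v (σ a) = v a)
    (hF : ∀ a, σ a = a → (2 : ℤ) ∣ v a)
    (h90 : ∀ a : A, a + σ a = 0 → ∃ b : A, a = b - σ b) {π : A} (hπ : v π = 1) :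
    (oneSubSigmaUnits σ v).relIndex (normOne σ v) = 2 := by
  rw [AddSubgroup.relIndex, AddSubgroup.index_eq_two_iff]
  have hg := seamGen_not_mem σ v hF hπ
  have h2g := two_nsmul_seamGen_mem σ v hσ hv π
  refine ⟨⟨π - σ π, seamGen_mem σ v hσ hv π⟩, fun b => ?_⟩
  simp only [AddSubgroup.mem_addSubgroupOf, AddSubgroup.coe_add]
  rcases seam_dichotomy σ v hσ hv h90 hπ b.2 with hb | hb
  · refine Or.inr ⟨hb, fun h => hg ?_⟩
    simpa using (oneSubSigmaUnits σ v).sub_mem h hb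
  · refine Or.inl ⟨?_, fun h => hg ?_⟩
    · have := (oneSubSigmaUnits σ v).add_mem hb h2g
      convert this using 1; abel
    · simpa using (oneSubSigmaUnits σ v).sub_mem h hb

/-- THE SEAM DIES UNDER EVERY NORM STEP (abstract two-layer form): `Nm : A' → A` the norm from layer
`m` to layer `n < m`, mapping `D' → D` (it commutes with `1-σ` and maps units to units) and the layer-`m`
seam generator to `2^{m-n}·(π - σπ) ∈ D` (`pow_nsmul_seamGen_mem`); then `Nm(M') ⊆ D`: the transition
maps of `(Ĥ⁻¹(C₂, U_{L_n}))_n` are ZERO, so `lim_n M_{L_n} = lim_n D_{L_n} = (1-σ)U_{L,∞}` — the B46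
(norm-one) presentation and the character presentation of `H¹_Iw(F_∞, T(key))` COINCIDE in `Λ_v`. -/
theorem seam_dies_under_norm {A' : Type*} [AddCommGroup A'] (M' D' : AddSubgroup A') (g' : A')
    (Nm : A' →+ A) (D : AddSubgroup A) (hD : ∀ a ∈ D', Nm a ∈ D) (hg : Nm g' ∈ D)
    (hdich : ∀ a ∈ M', a ∈ D' ∨ a - g' ∈ D') {a : A'} (ha : a ∈ M') : Nm a ∈ D := by
  rcases hdich a ha with h | h
  · exact hD a h
  · have := D.add_mem (hD _ h) hg
    simpa [map_sub] using this

/-- a norm-coherent sequence of norm-one units lies in `D` at every layer (apply the previous lemma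
to `a_n = Nm a_{n+1}`):  stated for one step. -/
theorem coherent_mem {A' : Type*} [AddCommGroup A'] (M' D' : AddSubgroup A') (g' : A')
    (Nm : A' →+ A) (D : AddSubgroup A) (hD : ∀ a ∈ D', Nm a ∈ D) (hg : Nm g' ∈ D)
    (hdich : ∀ a ∈ M', a ∈ D' ∨ a - g' ∈ D') {a' : A'} {a : A} (ha' : a' ∈ M') (hcoh : Nm a' = a) :
    a ∈ D :=
  hcoh ▸ seam_dies_under_norm M' D' g' Nm D hD hg hdich ha'

/-- LOG COROLLARY: if the seam generator is TORSION (`log g = 0`: `g = i` when `i ∈ L_n`, `g = -1` for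
the conductor-8 keys) the finite-layer log lattices of `M` and `D` agree; the only layer where they
differ is `(u,n) = (3,0)` (`g = -(2+√3)`, `log g = √3·λ`, `λ ≡ -2 (mod 8)`): row 86's «jump» is the
seam class made visible by `log`, and it is absent from the universal norms. -/
theorem map_normOne_eq_of_gen (M D : AddSubgroup A) (g : A) (hDM : D ≤ M)
    (hdich : ∀ a ∈ M, a ∈ D ∨ a - g ∈ D) {O : Type*} [AddCommGroup O] (lg : A →+ O) (hg : lg g = 0) :
    M.map lg = D.map lg := by
  refine le_antisymm ?_ (AddSubgroup.map_mono hDM)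
  rintro x ⟨a, ha, rfl⟩
  rcases hdich a ha with h | h
  · exact ⟨a, h, rfl⟩
  · exact ⟨a - g, h, by simp [map_sub, hg]⟩

end Seam

/-! ## §F  Layer-0 anchors (decidable) and the conductor–discriminant arithmetic -/

/-- even keys `u ≡ 2 (mod 8)` (`u = 2, -6`): a norm-one `α + β√u ∈ ℤ₂[√u]` has `β` even and `α` odd,
i.e. lies in `±U⁽³⁾ = ±(1 + 2√u ℤ₂ + 4ℤ₂)`:  `M = {±1} × M⁽³⁾` at layer 0. -/
theorem layer0_key_2 : ∀ a b : ZMod 8, a ^ 2 - 2 * b ^ 2 = 1 →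
    (∃ c : ZMod 8, b = 2 * c) ∧ a ^ 2 = 1 := by decide

/-- even keys `u ≡ 6 ≡ -2 (mod 8)` (`u = -2, 6`): same conclusion. -/
theorem layer0_key_6 : ∀ a b : ZMod 8, a ^ 2 - 6 * b ^ 2 = 1 →
    (∃ c : ZMod 8, b = 2 * c) ∧ a ^ 2 = 1 := by decide

/-- odd key `u = -1`: a norm-one `α + βi ∈ ℤ₂[i]` has its even coordinate `≡ 0 (mod 4)`, i.e. lies in
`μ₄ · U⁽³⁾`: `M = μ₄ × M⁽³⁾`, `log M = 4i ℤ₂` (k1-g27's layer 0, re-certified as a congruence). -/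
theorem layer0_key_neg1 : ∀ a b : ZMod 8, a ^ 2 + b ^ 2 = 1 →
    (∃ c : ZMod 8, b = 4 * c) ∨ (∃ c : ZMod 8, a = 4 * c) := by decide

/-- odd key `u = 3` (`≡ -5`): mod 8 the norm form ALLOWS `β` odd (witness `2 + √3`, §A
`eps_typeI_three`), and then forces `α ≡ 2 (mod 4)`: the anomalous class `1 + π`. -/
theorem layer0_key_3 : ∀ a b : ZMod 8, a ^ 2 - 3 * b ^ 2 = 1 →
    (∃ c : ZMod 8, b = 2 * c) ∨ (∃ c : ZMod 8, a = 2 + 4 * c) := by decide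

/-- conductor–discriminant for a ramified class `u`: `v₂(disc ℚ₂(√u)) = v₂(4u) = 2 + v₂(u)`
(`= 2` for `u ∈ {-1, 3}`, `= 3` for `u ∈ {±2, ±6}`). -/
theorem padicValNat_four_mul {n : ℕ} (hn : n ≠ 0) : padicValNat 2 (4 * n) = 2 + padicValNat 2 n := by
  haveI : Fact (Nat.Prime 2) := ⟨Nat.prime_two⟩
  rw [padicValNat.mul (by norm_num) hn, show (4 : ℕ) = 2 ^ 2 by norm_num, padicValNat.prime_pow]

/-- «the two half-integers cancel»: Gauss digit `-f(χ_u)/2` plus de Rham normalisation `v₂(√u) = v₂(u)/2`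
is `-1` for EVERY key, since `f(χ_u) = 2 + v₂(u)`. -/
theorem halves_cancel (v : ℚ) : -(2 + v) / 2 + v / 2 = -1 := by ring

/-! ## §G  Named ceiling Props (statement-only shapes; unchanged from the pre-row-86 draft)

The analytic inputs behind §D (`hU3`, `hproj`, `hhit`) are statements about the TREE's
`Literature.IUT.LogVolume.unitLog` on a dyadic field with `e = 2` (v5.8 P19′/B47: no new definition);
they map onto k3-g30's helpers H1–H3.  The Props below fix the exact one-layer shapes; §H says LOWER
needs even less. -/

def KeyedLayerConclusion (O k : Type) [CommRing O] [Field k] [CharP k 2] (red : O →+* k)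
    (B : AddSubgroup O) (evenKey : Bool) : Prop :=
  if evenKey then B = ⊤ else B = wpLattice red

/-- the located digit LOWER reads (k1-g27 `lower_oneSided_budget`, ceiling form): `ϖ_v(key) ≤ 1`
for all six keys — KEY-FREE; typed as the index statement on one layer:
`[𝒪_F : B] ∣ 2` (`= 1` even keys, `= 2` odd keys). -/
def KeyFreeCeiling (O : Type) [CommRing O] (B : AddSubgroup O) : Prop := B.index ∣ 2

theorem keyFreeCeiling_typeII {O : Type} [CommRing O] (B : AddSubgroup O) (h : B = ⊤) :
    KeyFreeCeiling O B := by
  subst h; simp [KeyFreeCeiling]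

theorem keyFreeCeiling_typeI {O k : Type} [CommRing O] [Field k] [Fintype k] [CharP k 2]
    [Algebra (ZMod 2) k] (red : O →+* k) (hred : Function.Surjective red) (B : AddSubgroup O)
    (h : B = wpLattice red) : KeyFreeCeiling O B := by
  subst h; simp [KeyFreeCeiling, index_wpLattice red hred]


/-! ## §H  R196‴ WEAKENED — the witness form of the ceiling `ϖ_v(key) ≤ 1` that LOWER consumes

`ϖ_v(key)` = the dual divisibility of `Col_fr = Lg_u` on `M_∞ = H¹_Iw(F_∞, T(key))` (k1-g27 Plan B:
`lower_oneSided_budget` consumes a CEILING).  A ceiling needs NO lattice equality and NO uniformity in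
`n`: if ONE element `z ∈ M_∞` has `Col_fr(z) ∉ 4Λ_v`, then `Col_fr ∉ 4·Hom_Λ(M_∞, Λ_v)`; and
`Col_fr(z) ∉ 4Λ_v` is witnessed at ONE finite layer (`θ_n : Λ_v → 𝒪_{F_n}` a ring map).  By §E the
witness must be a universal norm, i.e. taken in `D = (1-σ)U` (NOT the seam class: `ε₃` at `(3,0)` has
`Lg = λ ∉ 4ℤ₂` but does not lift to `M_∞`).  Witnesses: conductor 8 — layer 0, `z = (1+√u)^{1-σ}`,
`Lg_u(z) = 2·pr_s log(1+√u) ∈ 2ℤ₂ˣ` (tree `norm_unitLog_one_add_eq_unif_of_sq_eq`); conductor 4 —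
layer 1 (`F_1 = ℚ₂(ω)`, `π = 1+i`), `z = (1+ωπ)^{1-σ}`, `Lg(z) = 2·pr_i log(1+ωπ) ≡ 2·℘(ω̄) = 2 (mod 4)`.
(Layer 0 has NO conductor-4 witness: `2·AS₀ = 4ℤ₂`.) -/

section Witness

/-- dual divisibility ceiling from one witness: `f z ∉ (4)` forbids `f = 4·g`. -/
theorem not_four_dvd_of_witness {R M : Type*} [CommRing R] [AddCommGroup M] [Module R M]
    (f : M →ₗ[R] R) (z : M) (hz : f z ∉ Ideal.span ({4} : Set R)) :
    ¬ ∃ g : M →ₗ[R] R, f = (4 : R) • g := by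
  rintro ⟨g, rfl⟩
  exact hz (Ideal.mem_span_singleton'.mpr ⟨g z, by simp [mul_comm]⟩)

/-- … and `f z ∉ (4)` in `Λ_v` is read off ONE layer: a ring map `θ : Λ → 𝒪` with `θ (f z) ∉ (4)`. -/
theorem not_mem_span_four_of_map {Λ O : Type*} [CommRing Λ] [CommRing O] (θ : Λ →+* O) {c : Λ}
    (h : θ c ∉ Ideal.span ({4} : Set O)) : c ∉ Ideal.span ({4} : Set Λ) := by
  intro hc
  obtain ⟨d, rfl⟩ := Ideal.mem_span_singleton'.mp hc
  exact h (Ideal.mem_span_singleton'.mpr ⟨θ d, by rw [map_mul, map_ofNat]⟩)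

/-- the conductor-4 layer-1 witness residue: in `𝔽₄ = 𝔽₂[ω]/(ω²+ω+1)`, `℘(ω) = ω² + ω = 1 ≠ 0`
(so `pr_i log(1+ωπ) ≡ 1 (mod 2)`, `Lg ≡ 2 (mod 4)`), while `℘` vanishes on `𝔽₂` (no layer-0 witness). -/
theorem witness_residue_layer1 :
    (∀ t : ZMod 2, t ^ 2 + t = 0) ∧
    ∀ (K : Type) [Field K] [CharP K 2] (ω : K), ω ^ 2 + ω + 1 = 0 → ω ^ 2 + ω = 1 := by
  refine ⟨by decide, fun K _ _ ω hω => ?_⟩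
  have h : ω ^ 2 + ω = -1 := by linear_combination hω
  rw [h, CharTwo.neg_eq]

end Witness


end Summit.BirchSwinnertonDyer.BirchSwinnertonDyer.Cruxes.SplitBadTwoLowerHalfOfFacts.SeamWitnessK1G28
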